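import Summits.ABC.IUTFork.Cor312LogKummerRoute2
import Summits.ABC.IUTFork.Cor312VolumesSummandsBridge
import Summits.ABC.IUTFork.Cor312KummerVolumeFrames
import Summits.ABC.IUTFork.Cor312ThetaAdmFrames
import HarnessLib

/-!
# [IUTchIII] Cor. 3.12, TEAM B — the log-Kummer route's CAPSTONE at the VERBATIM weighted container:
# `Statement ⟸ QFrobEqualityAt 0` + instance data + the four named finiteness residuals, nothing else

Record-only file (D-0012) of the abc-iut cell (Cor. 3.12 strategy TEAM B «estimate / log-Kummer», HUMAN RULING
D-0067 (3), seat abc-iut-c312-6 gen 3); PROOF-ONLY; TAKES NO SIDE. abc-iut-c312-11's route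
(`Cor312LogKummerRoute2.statement_of_qFrobComparison`, p411648) gives the printed `Statement` of [IUTchIII] Cor. 3.12
from `BridgeHyps` + `Column.KummerA` (Thm. 3.11 (ii) (a)) + `ThetaRegionsAdm` + the B-INPUT `QFrobComparison` (the
(xi-g) comparison p. 184 l. 30–34, GAP row G-c312-11-1 — never asserted). abc-iut-c312-12's capstone
(`Cor312TeamBCapstone.teamB_capstone_of_latticeRealisations`, p413800) composes it over the
SINGLE-normalised-Haar-container criteria (the Dupuy–Hilado-normalised model). THIS FILE is the twin over the
VERBATIM container of [IUTchIII] Rmk. 3.1.1 (iii) p. 95 — abc-iut-c312-5's `SummandPieces` ("direct product regions"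
over the SUMMANDS `v⃗`, `Σ_{v⃗} w_{v⃗}·log μ_{v⃗}`), the container that carries `BridgeHyps.image_adm` under (Ind1)/(Ind2)
(abc-iut-c312-5 `bridgeHyps_of_summands`):

* `SummandPieces.teamB_statement_of_qFrobEqualityAt` — for a setting `P` over a lattice situation whose line
  `S'.D P.n` REALISES `V` with container-preserving (Ind1)/(Ind2) generators (`GeneratorsPreserve`), whose column
  `S'.col P.n` reads its (a)-data through container-preserving realisations `Ψ_m` of the Kummer isomorphisms
  (abc-iut-c312-6 `kummerA_of_preservesRegions`, p413059), and whose `m`-th Θ-Kummer images are the `Ψ_m`-transports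
  of ONE admissible reference region (`thetaRegionsAdm_of_preservesRegions`, p413564): **`P.Statement` follows from
  `QFrobEqualityAt P 0`** (the printed uniform-equality form of the B-INPUT) and exactly FOUR named residuals of
  the finiteness side — the (Ind3)-enlarged Θ-region admissible (`hθ`) with finitely supported log-volume (`hfin`,
  Prop. 3.9 (iii)), hull-sets nonempty (`hul_nonempty`), `ThetaFinite` (abc-iut-c312-7 `hullDefined_of_stable`);
  `teamB_statement_of_qFrobComparison` — the same from the route's `≤`/`∃ m` form.
* `SummandPieces.volumeTransport_iff_qFrobEqualityAt` is NOT claimed; what IS recorded: under the same instance data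
  the route's coric-side `VolumeTransport` is equivalent to its uniform form at `m = 0`
  (`volumeTransport_iff_at_of_preservesRegions`, p413564) — the adjudication target is ONE comparison per packet.

Why a twin: abc-iut-c312-12's criteria (p411395/p411464/p413177) read ONE normalised Haar container per packet; the
verbatim container is a WEIGHTED sum over summands (weights of Rmk. 3.1.1 (ii), not uniform in general), and — per
abc-iut-c312-5's finding (STATUS 2026-08-25T23:03Z) — it is the container on which the possible images stay admissible.
Sources read on the page (kurims `paper:url-4b091feeb646`): [IUTchIII] pp. 94–96 (Rmk. 3.1.1 (ii)(iii)), pp. 155–156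
(Thm. 3.11 (ii)), pp. 173–174 (Cor. 3.12), p. 184 (Step (xi-g)). [claim: Mochizuki2012, status: disputed]
NO new definition, NO new `Prop`; every hypothesis is instance data, a named residual of record, or THE B-INPUT.
Deliberately NOT here: any claim that `QFrobEqualityAt` holds at a real setting; the instance data themselves
(abc-iut-c312-3 / c312-5); judgement on Cor. 3.12.
-/

noncomputable section

open Set

namespace Summit.ABC

namespace IUTFork

namespace Cor312Vol

open Thm311 Cor312 Literature.IUT.LogThetaLattice

namespace SummandPieces

variable {T : ThetaIndex} {S' : LatticeSituation T} (P : Cor312.Setting S'.toSituation)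
  (V : SummandPieces S'.L)
  (Ψ : ℤ → ∀ (j : T.Label) (vQ : T.VQ), (∀ e, V.X j vQ e) → ∀ e, V.X j vQ e)
  (R : ∀ (j : T.Label) (vQ : T.VQ), Set (S'.L.Packet j vQ))

/-- **TEAM B CAPSTONE at the verbatim weighted container (route form).** Instance data: the line realises `V`
(`hV`) with container-preserving (Ind1)/(Ind2) generators (`hG`); the column's (a)-data are `V`'s readings through
container-preserving Kummer realisations `Ψ_m` (`hΨ`, `hfrobAdm`, `hfrobLogvol`); the Θ-Kummer images are the
`Ψ_m`-transports of one admissible reference region (`hthetaEq`, `hR`). Named residuals: `hθ`, `hfin`,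
`hul_nonempty`, `finite`. Then the route's B-INPUT `QFrobComparison P` gives the printed `Statement` — via
abc-iut-c312-11 `statement_of_qFrobComparison`, abc-iut-c312-5 `bridgeHyps_of_summands`, and this seat's
`kummerA_of_preservesRegions` / `thetaRegionsAdm_of_preservesRegions`. NOT a judgement: the B-INPUT is the named
gap (G-c312-11-1). [claim: Mochizuki2012, status: disputed] -/
theorem teamB_statement_of_qFrobComparison (hV : V.Realizes (S'.D P.n)) (hG : V.GeneratorsPreserve)
    (hΨ : ∀ (m : ℤ) (j : T.Label) (vQ : T.VQ), V.PreservesRegions j vQ (Ψ m j vQ))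
    (hfrobAdm : ∀ (m : ℤ) (j : T.Label) (vQ : T.VQ) (A : Set (S'.L.Packet j vQ)),
      (S'.col P.n).frobAdm m j vQ A ↔
        ∃ R' : ∀ e, Set (V.X j vQ e),
          Ψ m j vQ '' (V.e j vQ '' A) = Set.pi univ R' ∧ ∀ e, V.adm j vQ e (R' e))
    (hfrobLogvol : ∀ (m : ℤ) (j : T.Label) (vQ : T.VQ) (A : Set (S'.L.Packet j vQ)),
      (S'.col P.n).frobLogvol m j vQ A =
        ∑ e, V.w j vQ e * V.logμ j vQ e (Function.eval e '' (Ψ m j vQ '' (V.e j vQ '' A))))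
    (hthetaEq : ∀ (m : ℤ) (i : Fin T.lstar) (vQ : T.VQ),
      V.e (Setting.labelSucc i) vQ '' P.thetaRegion m (Setting.labelSucc i) vQ =
        Ψ m (Setting.labelSucc i) vQ '' (V.e (Setting.labelSucc i) vQ '' R (Setting.labelSucc i) vQ))
    (hR : ∀ (i : Fin T.lstar) (vQ : T.VQ), V.Adm (Setting.labelSucc i) vQ (R (Setting.labelSucc i) vQ))
    (hθ : ∀ (i : Fin T.lstar) (vQ : T.VQ), (S'.D P.n).Adm _ vQ (P.thetaRegion3 (Setting.labelSucc i) vQ))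
    (hfin : ∀ i : Fin T.lstar, (Function.support fun vQ : T.VQ =>
      (S'.D P.n).logvol _ vQ (P.thetaRegion3 (Setting.labelSucc i) vQ)).Finite)
    (hul_nonempty : ∀ (j : T.Label) (vQ : T.VQ), ∀ H ∈ (P.frame j vQ).Hul, H.Nonempty)
    (finite : P.ThetaFinite) (h : QFrobComparison P) : P.Statement :=
  statement_of_qFrobComparison P (bridgeHyps_of_summands hV hG hθ hfin hul_nonempty finite)
    (V.kummerA_of_preservesRegions (S'.col P.n) (S'.D P.n) Ψ hV hΨ hfrobAdm hfrobLogvol)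
    (V.thetaRegionsAdm_of_preservesRegions P Ψ R hV hΨ hthetaEq hR) h

/-- **TEAM B CAPSTONE at the verbatim weighted container (printed form of the B-INPUT).** As above, from the
UNIFORM EQUALITY form `QFrobEqualityAt P 0` — "two tautologically equivalent ways to compute the log-volume of the
`q`-pilot object at `(1,0)`" ([IUTchIII] p. 184 l. 30–34), the one gluing position for all packets.
[claim: Mochizuki2012, status: disputed] -/
theorem teamB_statement_of_qFrobEqualityAt (hV : V.Realizes (S'.D P.n)) (hG : V.GeneratorsPreserve)
    (hΨ : ∀ (m : ℤ) (j : T.Label) (vQ : T.VQ), V.PreservesRegions j vQ (Ψ m j vQ))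
    (hfrobAdm : ∀ (m : ℤ) (j : T.Label) (vQ : T.VQ) (A : Set (S'.L.Packet j vQ)),
      (S'.col P.n).frobAdm m j vQ A ↔
        ∃ R' : ∀ e, Set (V.X j vQ e),
          Ψ m j vQ '' (V.e j vQ '' A) = Set.pi univ R' ∧ ∀ e, V.adm j vQ e (R' e))
    (hfrobLogvol : ∀ (m : ℤ) (j : T.Label) (vQ : T.VQ) (A : Set (S'.L.Packet j vQ)),
      (S'.col P.n).frobLogvol m j vQ A =
        ∑ e, V.w j vQ e * V.logμ j vQ e (Function.eval e '' (Ψ m j vQ '' (V.e j vQ '' A))))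
    (hthetaEq : ∀ (m : ℤ) (i : Fin T.lstar) (vQ : T.VQ),
      V.e (Setting.labelSucc i) vQ '' P.thetaRegion m (Setting.labelSucc i) vQ =
        Ψ m (Setting.labelSucc i) vQ '' (V.e (Setting.labelSucc i) vQ '' R (Setting.labelSucc i) vQ))
    (hR : ∀ (i : Fin T.lstar) (vQ : T.VQ), V.Adm (Setting.labelSucc i) vQ (R (Setting.labelSucc i) vQ))
    (hθ : ∀ (i : Fin T.lstar) (vQ : T.VQ), (S'.D P.n).Adm _ vQ (P.thetaRegion3 (Setting.labelSucc i) vQ))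
    (hfin : ∀ i : Fin T.lstar, (Function.support fun vQ : T.VQ =>
      (S'.D P.n).logvol _ vQ (P.thetaRegion3 (Setting.labelSucc i) vQ)).Finite)
    (hul_nonempty : ∀ (j : T.Label) (vQ : T.VQ), ∀ H ∈ (P.frame j vQ).Hul, H.Nonempty)
    (finite : P.ThetaFinite) (h0 : QFrobEqualityAt P 0) : P.Statement :=
  teamB_statement_of_qFrobComparison P V Ψ R hV hG hΨ hfrobAdm hfrobLogvol hthetaEq hR hθ hfin hul_nonempty
    finite (qFrobComparison_of_equalityAt h0)

/-- Bookkeeping record: under the same realisation data the route's coric-side B-INPUT `VolumeTransport P` IS its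
uniform form at the gluing position `m = 0` (this seat's `volumeTransport_iff_at_of_preservesRegions`) — the
adjudication target at the verbatim container is ONE comparison per packet. [folklore] -/
theorem volumeTransport_iff_at_zero_of_preservesRegions (hV : V.Realizes (S'.D P.n))
    (hΨ : ∀ (m : ℤ) (j : T.Label) (vQ : T.VQ), V.PreservesRegions j vQ (Ψ m j vQ))
    (hthetaEq : ∀ (m : ℤ) (i : Fin T.lstar) (vQ : T.VQ),
      V.e (Setting.labelSucc i) vQ '' P.thetaRegion m (Setting.labelSucc i) vQ =
        Ψ m (Setting.labelSucc i) vQ '' (V.e (Setting.labelSucc i) vQ '' R (Setting.labelSucc i) vQ))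
    (hR : ∀ (i : Fin T.lstar) (vQ : T.VQ), V.Adm (Setting.labelSucc i) vQ (R (Setting.labelSucc i) vQ)) :
    VolumeTransport P ↔ VolumeTransportAt P 0 :=
  V.volumeTransport_iff_at_of_preservesRegions P Ψ R hV hΨ hthetaEq hR 0

end SummandPieces

end Cor312Vol

end IUTFork

end Summit.ABC

end
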